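import Mathlib
import HarnessLib
import HarnessLib.Audit
import Summits.HubbardSuperconductivity.Statement
import Literature.MathematicalPhysics.QuantumLattice.GaugedHubbardTorus
import HarnessLib.Audit.Status.Attr

/-!
Route: EatTheGoldstone

DORMANT since 2026-08-21T10:02:48Z (reconciler: no traction for 5 d (last activity statement-closed at 2026-08-16T09:35:03Z); parked, not closed — `ledger route dormant route-HubbardSuperconductivity-EatTheGoldstone --off` to reactivate) — unstaffed, not closed; items shared with open routes are served there. `ledger route dormant <id> --off` reactivates.

THESIS X (card eat-the-goldstone; it suffices to show X := HiggsShadow ∧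
StiffnessForcesCondensation, decls of this route). REGULARISE THE INFRARED BY RESTORING
ELECTROMAGNETISM. Couple the conserved charge of hubbardTorus 2 L 1 U minimally to a dynamical
lattice U(1) gauge field of charge e (Peierls factors e^{iea_b}, Maxwell terms ½ΣE_b²+½Σ_p(curl
a)_p², Gauss law div E = e(n_x − N_L/L²)). At e = 0 the matter decouples exactly (free photons ⊗ the
summit's Hamiltonian); at e > 0 Elitzur's theorem deletes every charged local order parameter and
the Goldstone boson is eaten: a d-wave pair condensate becomes a Higgs phase with unbroken Z₂, i.e.
Z₂ TOPOLOGICAL ORDER (Hansson–Oganesyan–Sondhi: four locally indistinguishable ground states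
labelled by the holonomies (θ_x,θ_y) ∈ {0,π}², vison = the screened hc/2e vortex, e-anyon = the
Bogoliubov quasiparticle, photon mass m_γ² = e²ρ_s). Topological order is the one kind of order with
an unconditional perturbative stability theory (Bravyi–Hastings–Michalakis, Michalakis–Zwolak,
Nachtergaele–Sims–Young), and the gauged pair-boson family contains an exact commuting anchor (pair
hopping κ → ∞ freezes the links to ±1: toric code in a transverse field Γ ∝ e²). The route proves
order on the GAUGED side (crux GaugedZ2TopologicalOrder, TYPED since rev 6 over
`gaugedHubbardTorusPhys L U e M ρ_L`: uniformly in e ∈ (0,e₀], even L ≥ L₀ and flux cut-off M ≥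
M₀(e,L), at most m eigenvalues lie below E₀ + c·e and at least m lie within w_L + C·e of E₀, m ∈
{4,8}, 0 ≤ C < c/8, w_L → 0 — the HOS flux quartet (×2 for a chiral condensate) with the photon mass
above it when L ≫ 1/e, the holonomy Born–Oppenheimer ladder when L ≪ 1/e; the refuted rev-5 window
form HasClusterGap 4 (w_L) (c·e) is its Higgs-regime corollary; LTQO split off as informal support
GaugedLTQO) and returns to e = 0 through ENERGIES, not order parameters: at fixed L the holonomy is
a slow Born–Oppenheimer variable of mass 1/e² in the potential V_L(θ) → E_L(θ) (the sector
ground-state energy of the flux-threaded pure torus), so "at most m states below c·e, m of them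
within w_L, for all small e" is, for L ≪ 1/e, literally the lattice Ward identity m_γ =
e·√(V_L''(s)) at the four well bottoms s ∈ {0,π}² plus their agreement to w_L, and points at the e →
0 SHADOW (typed NOW over existing declarations, crux HiggsShadow): a uniform helicity modulus ρ₀θ² −
o(1) ≤ E_L(θ) − E_L(0) on |θ| ≤ π/2 and hc/2e flux periodicity |E_L(θ+π) − E_L(θ)| → 0 for the PURE
model at some (U,δ), bundled with d-wave channel selection at the same (U,δ). The BRIDGE (crux
StiffnessForcesCondensation, typed): stiffness + hc/2e periodicity force a macroscopic ρ₂ eigenvalue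
for EVERY sector ground-state sequence (converse Byers–Yang/Sewell at T = 0, d = 2; insulators fail
stiffness, metals fail periodicity, charge-4e fails stiffness at θ = π/2). Assembly (pure logic,
checked in the planner's sketch): HiggsShadow → StiffnessForcesCondensation →
HubbardSuperconductivity (instantiate (U,δ); the Bridge gives the macroscopic eigenpair along even
sides; the selection clause of HiggsShadow turns it into HasLongRangeOrder of torusPullback
(pairFieldCorr dWaveFormFactor ψ) (2k)). One-line Lean form of X, in namespace
Summit.HubbardSuperconductivity.HubbardSuperconductivity.Theses.EatTheGoldstone —
Lean: `HiggsShadow ∧ StiffnessForcesCondensation`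
— every constant used (hubbardTorus, szSector, IsGroundStateInSector, fermionTorusGraph,
FermionTorus.toTorusSite, creation, annihilation, orb, numberOp, twoParticleRDM, pairFieldCorr,
dWaveFormFactor, torusPullback, halfOpenBox, HasLongRangeOrder, Matrix.minEnergyOn) exists and the
sketch elaborates (lean check rc 0).
TWO-LAYER PLAN (D-0019): cruxes first — rank 2 GaugedZ2TopologicalOrder (the bet; typed since rev 6
— gaugedHubbardTorus landed 2026-08-15; hubbardTorusFlux landed for the sibling route), rank 3
HiggsShadow (typed; its first split, once rank 2 names (U₀,δ₀), is {FluxShadowAt(U₀,δ₀),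
DWaveSelectionAt(U₀,δ₀)}), rank 4 StiffnessForcesCondensation (typed, a stand-alone Literature-grade
theorem if true, shared in content with card flux-spectroscopy-klein-bottle). Glue later:
HiggsTransfer (gauged TO ⇒ shadow clause (ii) + local stiffness at fixed L by Born–Oppenheimer; the
uniform floor η of the shadow is NOT delivered at fixed L — see NOT DECOMPOSED YET), GaugedLTQO
(clause (b), informal), WardPhotonMass, GaugedDictionary (Elitzur + e = 0 decoupling + holonomy
sectors), ToricCodeAnchor (BHM/MZ-type stability — the only place an unproved named fact,
Literature.MathematicalPhysics.QuantumLattice.michalakis_zwolak, is touched; no typed item imports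
it), TwistEnergyBounds (typed, provable now: H_0 = hubbardTorus, E even and 2π-periodic, E_L(θ) −
E_L(0) ≤ 2θ², which caps ρ₀ ≤ 2).

Rationale: WHY THIS LINE. Every S-side route dies in the same place: at T=0, d=2 the pair phase is a type-A
Goldstone field, finite tori carry a gapless tower (barrier LROForcesLowLyingStates, a THEOREM in
the tree) and no continuation/stability theorem applies; U(1) ground-state order in d=2 is proved
only by reflection positivity (KennedyLiebShastry1988) or abelian duality. Real superconductors do
not have the disease: the Goldstone is eaten. Imported areas, with an explicit lattice dictionary
(HanssonOganesyanSondhi2004; Fradkin2013 §14.5 pp.521–529; FradkinShenker1979 charge-2 Higgs ≠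
confinement): (i) topological order and its stability theory (BravyiHastingsMichalakis2010,
BravyiHastings2011, MichalakisZwolak2013, NachtergaeleSimsYoung2021/2024); (ii) rigorous lattice
Higgs mechanism for bosonic abelian Higgs models (BalabanEtAl1984, KennedyKing1986, BorgsNill1987);
(iii) flux/stiffness spectroscopy of ground-state energies (ByersYang1961, Kohn1964,
ScalapinoWhiteZhang1993, Sewell1990; LiebSeiringerSolovejYngvason2005 §5.2 eq.(5.18), p.40:
superfluidity vs BEC open in general). Catalogue entry used: physical analogy WITH dictionary (gauge
field as removable IR regulator) + spectral reformulation (energies under flux).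
RANKED CRUXES. (2) GaugedZ2TopologicalOrder [TYPED rev 6/7 = stmt-HubbardSuperconductivity-13915,
over gaugedHubbardTorusPhys L U e M ρ_L with a fixed {0,1} background ρ_L, Σρ_L = N_L]: ∃(U,δ),
m∈{4,8}, ρ, e₀, c>0, C∈[0,c/8), w_L→0, L₀, M₀: ∀e∈(0,e₀] ∀ even L≥L₀ ∀M≥M₀(e,L): (a1) at most m
eigenvalues below E₀ + c·e, (a2) at least m eigenvalues ≤ E₀ + w_L + C·e — both counted from E₀ (the
refuter's fixed-L/e→0 Born–Oppenheimer ladder witness kills only the rev-5 window form HasClusterGap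
4 (w_L) (c·e), which is now the Higgs-regime corollary once w_L + Ce < ce). Why it might fail: (a1)
needs a fully gapped, tower-free condensate with B1g weight; B1g nodes are symmetry-forced wherever
the Fermi surface meets the zone diagonal (m = 4 has no documented home at t'=0, δ<1/2); m = 8 bets
on the weak-coupling chiral d_{x²−y²}±id_{xy} sliver at the B1g/B2g crossing n≈0.6
(RaghuKivelsonScalapino2010 p.7, SigristUeda1991, ReadGreen2000) with gaps ~e^{−1/(αU²)}; reach:
stability balls ∝ e, no non-frustration-free TO-stability theorem, and the crossover L≈1/e is
controlled by neither the anchor nor Born–Oppenheimer. (3) HiggsShadow [typed]: the e→0 shadow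
(stiffness on |θ|≤π/2 + hc/2e periodicity of E_L(θ) := minEnergyOn of the flux-threaded torus in
szSector N_L 0) at some (U,δ) ∧ d-wave selection there. (4) StiffnessForcesCondensation [typed]:
shadow ⇒ macroscopic ρ₂ eigenpair for every sector-GS sequence along even sides.
KILL CRITERIA. Bridge refuted by a 2D lattice witness (stiffness + hc/2e periodicity, no ODLRO) ⇒
restate ONCE with a parity-gap hypothesis (chargeGap ≥ 2Δ₀); refuted again ⇒ close. Certified
ED/DMRG ENERGIES (sign-free use: energies only) on even tori L=4,6,8 at every (U,δ) where clusters
bind d-wave pairs showing E_L(π)−E_L(0) not decreasing or curvature < 0 ⇒ dormant. Worm-QMC of the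
sign-free gauged charge-2 boson proxy: Higgs phase does not reach physical pair hopping for any e ⇒
rank-2 anchor path dead ⇒ close unless a non-FF TO-stability theorem has landed. HiggsShadow's
selection half refuted at the (U₀,δ₀) named by rank 2 (condensate not B1g / no n.n. weight) ⇒ move
(U,δ) once, then close. Rank 2 (repaired): a symmetry/BdG argument or certified weak-coupling
computation showing that at the B1g/B2g crossing of the t'=0 model the paired state is REAL (nematic
d+d′, nodal) rather than chiral d±id′ — together with symmetry-forced B1g nodes everywhere else —
leaves m∈{4,8} without a home ⇒ drop rank 2 and its gauged supports, and either keep the route on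
HiggsShadow + Bridge alone if refuters see independent value or supersede it by FluxSpectroscopy
(shared Bridge content); a typed refutation of (a1)∧(a2) for every (U,δ) (e.g. towers surviving
gauging) ⇒ same.
NOT DECOMPOSED YET. THE SEAM left by the repair (tenure decision after refuters vet rank 2): the
fixed-L Higgs transfer reads (a2) as flux-bottom insensitivity |E_L(π,0) − E_L(0,0)| ≤ O(w_L) =
HiggsShadow (A)(ii) and (a1) as local curvature κ ≥ (c/m)² at the wells, but spectral data at scale
c·e bound V_L = E_L − min only up to height O(e): the UNIFORM floor η / global quadratic bound on
|θ| ≤ π/2 of HiggsShadow (A)(i) is not delivered at fixed L; options are (α) the Higgs-regime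
transfer at fixed e₀, L → ∞ (dressed trial states, the hard direction) or (β) a 1/L-floor variant of
HiggsShadow and the Bridge (η_L = η₁/L, w_L = o(1/L)), to be chosen only once rank 2 survives
vetting. Also left: the truncation-removal M → ∞ lemma; the anchor-to-physical path (κ,
re-fermionisation); the LTQO clause (support GaugedLTQO, definition want defn-GaugedHubbard.HasLTQO)
and the Wilson-line sector labelling (defn-GaugedHubbard.cycleRaise) with which a sector-resolved
refinement (refuter repair C″) would be stated; the Z₄-clock discrete twin of the card (kept in
reserve: no typed object today); parity gap / e-anyon gap (belongs to card
parity-gap-lemma-rigidity); the Klein-bottle channel test of flux-spectroscopy-klein-bottle (would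
replace the selection half of HiggsShadow if that card is routed — share, do not duplicate).
CHEAPEST FALSIFIER. For rank 2: the two-channel BdG/Ginzburg–Landau computation at the
Raghu–Kivelson–Scalapino weak-coupling crossing n≈0.6, t'=0 — is the T=0 combination of the
degenerate B1g and B2g solutions chiral (d±id′, nodeless ⇒ m=8 has a home) or real (nematic, nodal ⇒
homeless)? For the route: free-fermion / Fermi-sea check of HiggsShadow (A)(ii) and the ED energies
E_L(θ) kill test above.
PRIOR PROGRAMME: docs/m5/inspiration not read (plancard mode; card-driven).
ITEM MAP (rev 8+). Cruxes: GaugedZ2TopologicalOrder = stmt-HubbardSuperconductivity-13915 (rank 2,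
TYPED; history 1839 → 13841 (rev 6) → 13915 (rev 7, C<c/8)), HiggsShadow = stmt-2242 (rank 3,
typed), StiffnessForcesCondensation = stmt-2243 (rank 4, typed). Assembly = stmt-1632 (pure logic);
deciding theorem `closes` (HiggsShadow → StiffnessForcesCondensation → HubbardSuperconductivity)
PROVED, untouched by the repair. Supports: TwistEnergyBounds = stmt-1631 (typed, provable now),
HiggsTransfer = stmt-13921 (re-filed rev 8, informal), GaugedDictionary = stmt-13922 (re-filed rev
8, informal), GaugedLTQO = stmt-13923 (new, informal: clause (b) of the old rank-2 text),
WardPhotonMass = stmt-2339, ToricCodeAnchor = stmt-2362 (informal). Definition wants: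
defn-GaugedHubbard.cycleRaise (Wilson lines; for 13921/13922/2339/13923), defn-GaugedHubbard.HasLTQO
(for 13923); landed: gaugedHubbardTorus (GaugedHubbardTorus.lean), hubbardTorusFlux (sibling route;
this route's inline uniform-gauge flux torus is gauge-equivalent — restate
HiggsShadow/StiffnessForcesCondensation/TwistEnergyBounds by name at a later tenure pass, not in
this repair). Sibling route: FluxSpectroscopy (card flux-spectroscopy-klein-bottle) — its FluxBridge
(stmt-1817) and this route's StiffnessForcesCondensation are two forms of the converse-Byers–Yang
bridge (theirs: exact quadratic stiffness, no periodicity clause; ours: floor-form stiffness with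
o(1) slack + flux-sector insensitivity |E_L(π)−E_L(0)| → 0, the form the gauged engine delivers);
neither implies the other verbatim; a refuter/tenure pass may merge them.

Novelty: Nearest prior art (searched: this session `lit search --hybrid "superconductors are topologically
ordered Z2 gauge theory Higgs vison flux quantization"` (held: Fradkin2013 §14.5 pp.521–529 = the
HOS dictionary at textbook level; Moessner–Moore 2021; Kita 2015), `lit galaxy search
"Superconductors are topologically ordered" --star all` (9 book hits citing HOS, 2 irrelevant pdf),
`lit galaxy --star pdf "stability of topological order lattice gauge theory"` and `"gauging the
Hubbard model"` (0 hits each), `lit frontier HubbardSuperconductivity --since 2020`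
(frustration-free fermions 2025/26, Yin–Lucas 2026; nothing gauges Hubbard to prove order), held
LiebSeiringerSolovejYngvason2005 §5.2 p.40 (superfluidity vs BEC 'unresolved … neither necessary for
the other'); remote cascade searchd rc 75 / arXiv 429 this session; plus the card's own crossref
sweep and the refuter audit 2026-08-15 (grade new-combination). KNOWN pieces:
HanssonOganesyanSondhi2004 (SC + dynamical EM = Z₂ TO: 4 torus sectors, vison = hc/2e vortex, BdG qp
= e-anyon; physics level); FradkinShenker1979 + BalabanEtAl1984 + KennedyKing1986 + BorgsNill1987
(rigorous Higgs phase of BOSONIC abelian lattice Higgs models; no fermions, no e→0 transfer);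
BravyiHastingsMichalakis2010, BravyiHastings2011, MichalakisZwolak2013,
NachtergaeleSimsYoung2021/2024 (TQO/LTQO stability, never pointed at a superconductor);
ByersYang1961, Kohn1964, ScalapinoWhiteZhang1993, Sewell1990 (flux period / stiffness criteria;
ODLRO ⇒ flux qua  [refs: Fradkin2013, LiebSeiringerSolovejYngvason2005, HanssonOganesyanSondhi2004, FradkinShenker1979, BalabanEtAl1984, KennedyKing1986, BorgsNill1987, BravyiHastingsMichalakis2010, BravyiHastings2011, MichalakisZwolak2013, NachtergaeleSimsYoung2021, ByersYang1961, Kohn1964, ScalapinoWhiteZhang1993, Sewell1990]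

Barriers (technique_class: gauged-regulator topological-order-stability flux-energies): Literature.Barriers.HubbardSuperconductivity.LROForcesLowLyingStates: the obstruction this route is
built to EVADE — Koma–Tasaki/Horsch–von der Linden low-lying states exist because a charged local
order parameter acts on a number-conserving ground state; after gauging there is no charged local
order parameter (Elitzur), the ground cluster is 4-dimensional and gapped at fixed e>0, and
gapped-phase technology applies; the barrier re-enters only at e=0, where it is met with ENERGIES
(HiggsShadow: helicity modulus and flux periodicity of sector ground-state energies, which do not
require a gap or a broken symmetry) and the Bridge, never with a uniform gap of the pure model.
Literature.Barriers.HubbardSuperconductivity.HohenbergMerminWagnerPairing: not met — T=0 sector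
ground states throughout; Z₂ TO in 2+1D is a T=0 notion; no continuation from T>0.
Literature.Barriers.HubbardSuperconductivity.PositiveTemperatureNoPairLRO: not met — no
positive-temperature statement is used or claimed.
Literature.Barriers.HubbardSuperconductivity.WeakCouplingCeiling: nothing is expanded in U, but it
BOUNDS THE REACH: at weak coupling Δ_qp ~ e^{-1/(αρ²U²)} makes every stability radius exponentially
small, so the engine is aimed at intermediate coupling / strong-pairing side by design (stated in
GaugedZ2TopologicalOrder's why-might-fail).
Literature.Barriers.HubbardSuperconductivity.PerturbativeInvisibilityOfPairing: not met — no
perturbation theory in U; the only perturbation theory is in the gau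

History (route lifecycle, newest last):
- 2026-08-15T11:00:52Z · rev 1: restated HiggsShadow (stmt-HubbardSuperconductivity-1629), StiffnessForcesCondensation (stmt-HubbardSuperconductivity-1630) — rev 1 (planner, pre-staffing): stiffness clause (i) weakened to the floor form min(ρ₀θ²,η) − w_L ≤ E_L(θ) − E_L(0) on |θ| ≤ π/2 in HiggsShadow and in the Bridge (planner-plancard-HubbardSuperconductivity-Hub-f7a4b632-0)
- 2026-08-15T11:01:11Z · rev 2: dropped stmt-HubbardSuperconductivity-1867 — drop informal support HiggsTransfer (stmt-1867) to re-file it at once with text matching rev 1's floor form of the stiffness clause; not load-bearing for the ty (planner-plancard-HubbardSuperconductivity-Hub-f7a4b632-0)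
- 2026-08-15T11:02:39Z · rev 3: restated HiggsShadow (stmt-HubbardSuperconductivity-2099), StiffnessForcesCondensation (stmt-HubbardSuperconductivity-2100) — rev 3 (planner, pre-staffing, last shape change): periodicity clause (ii) reduced to the flux-sector bottoms |E_L(π) − E_L(0)| ≤ w_L in HiggsShadow and in the B (planner-plancard-HubbardSuperconductivity-Hub-f7a4b632-0)
- 2026-08-15T21:31:05Z · rev 6: restated GaugedZ2TopologicalOrder (stmt-HubbardSuperconductivity-1839) — repair rev 6: GaugedZ2TopologicalOrder (stmt-1839) refuted-misstated by refuter-rattack-stmt-HubbardSuperconductivity-1839-0 (fixed-L e→0 Born–Oppenheimer ladde (planner-rrefute-HubbardSuperconductivity-EatTh-7448fcb1-0)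
- 2026-08-15T21:35:16Z · rev 7: restated GaugedZ2TopologicalOrder (stmt-HubbardSuperconductivity-13841) — repair rev 7 (same seat, tightening of rev 6): in GaugedZ2TopologicalOrder constrain the width slack to C ∈ [0, c/8) (was [0,c)) so that clause (a2) cannot be m (planner-rrefute-HubbardSuperconductivity-EatTh-7448fcb1-0)
- 2026-08-15T21:35:36Z · rev 8: dropped HiggsTransfer, GaugedDictionary — rev 8: drop the informal supports HiggsTransfer (stmt-2167) and GaugedDictionary (stmt-2302) to re-file them at once with texts matching the repaired typed crux (planner-rrefute-HubbardSuperconductivity-EatTh-7448fcb1-0)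
- 2026-08-21T10:02:48Z · DORMANT — reconciler: no traction for 5 d (last activity statement-closed at 2026-08-16T09:35:03Z); parked, not closed — `ledger route dormant route-HubbardSuperconductiv (operator:999:1393508)

sub-problem: HubbardSuperconductivity · status: dormant · opened planner-plancard-HubbardSuperconductivity-Hub-f7a4b632-0 2026-08-15T10:57:42Z · rev 9 · ledger route-HubbardSuperconductivity-EatTheGoldstone
GENERATED by the gate from the ledger (D-0016/17). Provers cite these decls: `theorem foo : Summit.HubbardSuperconductivity.HubbardSuperconductivity.Theses.EatTheGoldstone.<Decl> := …` in Summits/HubbardSuperconductivity/HubbardSuperconductivity/Theorems/<Name>.lean.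
-/

namespace Summit.HubbardSuperconductivity.HubbardSuperconductivity.Theses.EatTheGoldstone

open scoped BigOperators Topology Manifold Classical MeasureTheory ProbabilityTheory Matrix InnerProductSpace ComplexConjugate ContinuousMap
open Filter Set Function TopologicalSpace MeasureTheory

attribute [summit_statement] _root_.HubbardSuperconductivity

open Literature.Hubbard

-- earlier GaugedZ2TopologicalOrder (stmt-HubbardSuperconductivity-13841, replaced 2026-08-15T21:35:16Z -> stmt-HubbardSuperconductivity-13915): retired by None — ∃ U : ℝ, 0 < U ∧ ∃ δ ∈ Set.Ioo (0 : ℝ) (1 / 2), ∃ m : ℕ, (m = 4 ∨ m = 8) ∧ ∃ ρ : (L : ℕ) → Literature.MathematicalPhysics.QuantumLattice.FermionTorus 2 L → ℤ, (∀ L x, ρ L x = 0 ∨ ρ L x = 1) ∧ (∀ L, ∑ x, ρ L x = ((2 * ⌊(1 - δ) * (L : ℝ) ^ 2 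
-- earlier GaugedZ2TopologicalOrder (stmt-HubbardSuperconductivity-1839, replaced 2026-08-15T21:31:05Z -> stmt-HubbardSuperconductivity-13841): retired by None — [crux, rank 2 — THE BET; informal until definition gaugedHubbardTorus lands] GAUGED Z₂ TOPOLOGICAL ORDER. Object: H_e(L,U) = hubbardTorus 2 L 1 U minimally coupled to a dynamical lattice U(1) gauge field of charge e (Peierls factors exp(i e 
/-- item stmt-HubbardSuperconductivity-13915 · crux · rank 2 · open · by planner
why it might fail: (a1) needs a fully gapped, tower-free B1g-weighted condensate of pure t'=0 Hubbard at δ<1/2: B1g nodes are symmetry-forced where the FS meets k_x=±k_y (m=4: no documented home); m=8 bets on chiral d±id′ at the B1g/B2g crossing n≈0.6 (RKS2010 p.7), gaps ~e^{-1/αU²}; no non-FF TO-stability theorem.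
sources: HanssonOganesyanSondhi2004, RaghuKivelsonScalapino2010, SigristUeda1991, ReadGreen2000, QinEtAl2020, BravyiHastingsMichalakis2010
[crux, rank 2 — THE BET; TYPED at rev 6 over the landed object, repaired after the refuter
crux-attack 2026-08-15 (fixed-L, e→0 corner)] GAUGED Z₂ TOPOLOGICAL ORDER. Object: H =
gaugedHubbardTorusPhys L U e M ρ_L (GaugedHubbardTorus.lean): hubbardTorus 2 L 1 U ⊗ compact
Kogut–Susskind U(1), electric-flux basis, e = the KS coupling g (electric (e²/2)ΣJ_b², magnetic
(1/2e²)Σ_p(2−W_p−W_p†), holonomy phases e-free, m_γ ∝ e), link fluxes truncated at |J_b| ≤ M,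
compressed to the Gauss law div J = n − ρ_L and 2S^z = 0, with ρ_L : sites → {0,1} a FIXED
background, Σρ_L = N_L = 2⌊(1−δ)L²/2⌋ (N = N_L on the block; large gauge transformations are
ordinary here). CLAIM (clause (a), typed): ∃U>0, δ∈(0,1/2), m∈{4,8}, ρ, e₀, c>0, C∈[0,c/8), w_L→0,
L₀, M₀(e,L): for ALL e∈(0,e₀], ALL even L≥L₀, ALL M ≥ M₀(e,L), with E₀ = min spec H: (a1) at most m
eigenvalues (with multiplicity) lie strictly below E₀ + c·e; (a2) at least m eigenvalues lie in [E₀,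
E₀ + w_L + C·e]. Both counts are measured FROM E₀ (C < c/8 keeps (a2) from being met by one soft
well's ladder: it must be met by the m well/sector ground states) — this is the repair: rev 5 asked
HasClusterGap 4 (w_L) (c·e), i.e. exactly four states in t -/
@[route_item "route-HubbardSuperconductivity-EatTheGoldstone"]
def GaugedZ2TopologicalOrder : Prop :=
  ∃ U : ℝ, 0 < U ∧ ∃ δ ∈ Set.Ioo (0 : ℝ) (1 / 2), ∃ m : ℕ, (m = 4 ∨ m = 8) ∧ ∃ ρ : (L : ℕ) → Literature.MathematicalPhysics.QuantumLattice.FermionTorus 2 L → ℤ, (∀ L x, ρ L x = 0 ∨ ρ L x = 1) ∧ (∀ L, ∑ x, ρ L x = ((2 * ⌊(1 - δ) * (L : ℝ) ^ 2 / 2⌋₊ : ℕ) : ℤ)) ∧ ∃ e₀ : ℝ, 0 < e₀ ∧ ∃ c : ℝ, 0 < c ∧ ∃ C ∈ Set.Ico (0 : ℝ) (c / 8), ∃ w : ℕ → ℝ, Filter.Tendsto w Filter.atTop (nhds 0) ∧ ∃ L₀ : ℕ, ∃ M₀ : ℝ → ℕ → ℕ, ∀ e ∈ Set.Ioc (0 :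 ℝ) e₀, ∀ (L : ℕ) [NeZero L], L₀ ≤ L → Even L → ∀ M : ℕ, M₀ e L ≤ M → ∃ hA : (Literature.MathematicalPhysics.QuantumLattice.gaugedHubbardTorusPhys L U e M (ρ L)).IsHermitian, (Finset.univ.filter fun i => hA.eigenvalues i < (⨅ j, hA.eigenvalues j) + c * e).card ≤ m ∧ m ≤ (Finset.univ.filter fun i => hA.eigenvalues i ≤ (⨅ j, hA.eigenvalues j) + w L + C * e).card

-- earlier HiggsShadow (stmt-HubbardSuperconductivity-1629, replaced 2026-08-15T11:00:52Z -> stmt-HubbardSuperconductivity-2099): retired by None — ∃ U : ℝ, 0 < U ∧ ∃ δ ∈ Set.Ioo (0 : ℝ) (1 / 2), (∃ ρ₀ : ℝ, 0 < ρ₀ ∧ ∃ w : ℕ → ℝ, Filter.Tendsto w Filter.atTop (nhds 0) ∧ ∃ L₀ : ℕ, ∀ (L : ℕ) [NeZero L], L₀ ≤ L → Even L → let H : ℝ → Matrix (Finset (Literature.MathematicalPhysics.QuantumLattice.Orb (Lite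
-- earlier HiggsShadow (stmt-HubbardSuperconductivity-2099, replaced 2026-08-15T11:02:39Z -> stmt-HubbardSuperconductivity-2242): retired by None — ∃ U : ℝ, 0 < U ∧ ∃ δ ∈ Set.Ioo (0 : ℝ) (1 / 2), (∃ ρ₀ : ℝ, 0 < ρ₀ ∧ ∃ η : ℝ, 0 < η ∧ ∃ w : ℕ → ℝ, Filter.Tendsto w Filter.atTop (nhds 0) ∧ ∃ L₀ : ℕ, ∀ (L : ℕ) [NeZero L], L₀ ≤ L → Even L → let H : ℝ → Matrix (Finset (Literature.MathematicalPhysics.Quantum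
/-- item stmt-HubbardSuperconductivity-2242 · crux · rank 3 · open · by planner
why it might fail: Needs ONE (U,delta) of pure t'=0 Hubbard with L-uniform floor-form stiffness AND d_{x2-y2} selection: at U~6-8, delta~1/8 DMRG/AFQMC find stripes, no SC (QinEtAl2020; SC needs t'!=0, XuEtAl2024); weak coupling keeps d_{x2-y2} for delta<0.4 (RKS2010 p.7) but xi~exp(1/U^2): (A)(i) open as the summit.
sources: QinEtAl2020, XuEtAl2024, RaghuKivelsonScalapino2010, LoderEtAl2007, ByersYang1961, Kohn1964
[crux, rank 3] e→0 SHADOW of the gauged topological order, typed now, bundled with d-wave SELECTION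
at the same (U,δ). H(θ) = pure torus threaded by flux θ through the x-cycle (uniform gauge, Peierls
exp(iθ/L) on forward x-bonds, inline; H(0) = hubbardTorus 2 L 1 U by TwistEnergyBounds); E_L(θ) =
minEnergyOn (H θ) (szSector N_L 0). CLAIM ∃U>0, δ∈(0,1/2): (A) ∃ρ₀,η>0, w_L→0, L₀, ∀ even L≥L₀: (i)
helicity modulus with a floor, min(ρ₀θ²,η) − w_L ≤ E_L(θ) − E_L(0) on |θ| ≤ π/2 (Kohn/SWZ curvature
near 0 + a positive floor away from it — the shape a gapped holonomy spectrum delivers; slack w_L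
absorbs o(1) wiggles); (ii) hc/2e flux insensitivity at the sector bottoms, |E_L(π) − E_L(0)| ≤ w_L
(Byers–Yang: half an electron flux quantum is invisible to a charge-2e condensate; a Fermi sea keeps
an O(1) difference; insulators fail (i); charge-4e fails the floor at θ=π/2); (B) for every
admissible sector-GS sequence, a macroscopic ρ₂ eigenpair along even sides ⇒ the summit conclusion
for pairFieldCorr dWaveFormFactor (B1g + n.n. weight; cf. YangSpectral stmt-0179 and the proved
hasPairFieldLRO_dWave_of_hasODLRO_holds). (A) is what GaugedZ2TopologicalOrder + HiggsTransfer
deliver (for L ≪ 1/e -/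
@[route_item "route-HubbardSuperconductivity-EatTheGoldstone", crux]
def HiggsShadow : Prop :=
  ∃ U : ℝ, 0 < U ∧ ∃ δ ∈ Set.Ioo (0 : ℝ) (1 / 2), (∃ ρ₀ : ℝ, 0 < ρ₀ ∧ ∃ η : ℝ, 0 < η ∧ ∃ w : ℕ → ℝ, Filter.Tendsto w Filter.atTop (nhds 0) ∧ ∃ L₀ : ℕ, ∀ (L : ℕ) [NeZero L], L₀ ≤ L → Even L → let H : ℝ → Matrix (Finset (Literature.MathematicalPhysics.QuantumLattice.Orb (Literature.MathematicalPhysics.QuantumLattice.FermionTorus 2 L))) (Finset (Literature.MathematicalPhysics.QuantumLattice.Orb (Literature.MathematicalPhysics.QuantumLattice.FermionTorus 2 L))) ℂ := fun θ : ℝ => -(∑ x : Literature.MathematicalPhysics.QuantumLattice.FermionTorus 2 L, ∑ y : Literature.MathematicalPhysics.QuantumLattice.FermionTorus 2 L, ∑ σ : Fin 2, (if (Literature.MathematicalPhysics.QuantumLattice.fermionTorusGraph 2 L).Adj x y then Complex.exp (Complex.I * ((θ / L : ℝ) : ℂ) * (if Literature.MathematicalPhysics.QuantumLattice.FermionTorus.toTorusSite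 y = Literature.MathematicalPhysics.QuantumLattice.FermionTorus.toTorusSite x + Pi.single 0 1 ∧ Literature.MathematicalPhysics.QuantumLattice.FermionTorus.toTorusSite x ≠ Literature.MathematicalPhysics.QuantumLattice.FermionTorus.toTorusSite y + Pi.single 0 1 then (1 : ℂ) else if Literature.MathematicalPhysics.QuantumLattice.FermionTorus.toTorusSite x = Literature.MathematicalPhysics.QuantumLattice.FermionTorus.toTorusSite y + Pi.single 0 1 ∧ Literature.MathematicalPhysics.QuantumLattice.FermionTorus.toTorusSite y ≠ Literature.MathematicalPhysics.QuantumLattice.FermionTorus.toTorusSite x + Pi.single 0 1 then (-1 : ℂ) else 0)) • (Literature.MathematicalPhysics.QuantumLattice.creation (Literature.MathematicalPhysics.QuantumLattice.orb x σ) * Literature.MathematicalPhysics.QuantumLattice.annihilation (Literature.MathematicalPhysics.QuantumLattice.orb y σ)) else 0)) + (U : ℂ) • ∑ x : Literature.MathematicalPhysics.QuantumLattice.FermionTorus 2 L, Literature.MathematicalPhysics.QuantumLattice.numberOp x 0 * Literature.MathematicalPhysics.QuantumLattice.numberOp x 1; let E : ℝ → ℝ := fun θ => Matrix.minEnergyOn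 (H θ) (Literature.MathematicalPhysics.QuantumLattice.szSector (Λ := Literature.MathematicalPhysics.QuantumLattice.FermionTorus 2 L) (2 * ⌊(1 - δ) * (L : ℝ) ^ 2 / 2⌋₊) 0); (∀ θ : ℝ, |θ| ≤ Real.pi / 2 → min (ρ₀ * θ ^ 2) η - w L ≤ E θ - E 0) ∧ |E Real.pi - E 0| ≤ w L) ∧ (∀ (N : ℕ → ℕ) (ψ : ∀ L, Literature.MathematicalPhysics.QuantumLattice.Fock (Literature.MathematicalPhysics.QuantumLattice.Orb (Literature.MathematicalPhysics.QuantumLattice.FermionTorus 2 L))), (∀ L, Even L → N L = 2 * ⌊(1 - δ) * (L : ℝ) ^ 2 / 2⌋₊ ∧ star (ψ L) ⬝ᵥ ψ L = 1 ∧ Literature.MathematicalPhysics.QuantumLattice.IsGroundStateInSector (Literature.MathematicalPhysics.QuantumLattice.hubbardTorus 2 L 1 U) (N L) 0 (ψ L)) → (∃ c : ℝ, 0 < c ∧ ∀ᶠ k : ℕ in Filter.atTop, ∃ v : Literature.MathematicalPhysics.QuantumLattice.Orb (Literature.MathematicalPhysics.QuantumLattice.FermionTorus 2 (2 * k)) ×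 Literature.MathematicalPhysics.QuantumLattice.Orb (Literature.MathematicalPhysics.QuantumLattice.FermionTorus 2 (2 * k)) → ℂ, ∃ ev : ℝ, star v ⬝ᵥ v = 1 ∧ Matrix.mulVec (Literature.MathematicalPhysics.QuantumLattice.twoParticleRDM (ψ (2 * k))) v = (ev : ℂ) • v ∧ c * (N (2 * k) : ℝ) ≤ ev) → Literature.Probability.LatticeModels.HasLongRangeOrder (fun k => Literature.Probability.LatticeModels.halfOpenBox 2 (2 * k)) (fun k => Literature.MathematicalPhysics.QuantumLattice.torusPullback (Literature.MathematicalPhysics.QuantumLattice.pairFieldCorr Literature.MathematicalPhysics.QuantumLattice.dWaveFormFactor ψ) (2 * k)))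

-- earlier StiffnessForcesCondensation (stmt-HubbardSuperconductivity-1630, replaced 2026-08-15T11:00:52Z -> stmt-HubbardSuperconductivity-2100): retired by None — ∀ (U δ ρ₀ : ℝ) (w : ℕ → ℝ) (L₀ : ℕ), 0 < U → δ ∈ Set.Ioo (0 : ℝ) (1 / 2) → 0 < ρ₀ → Filter.Tendsto w Filter.atTop (nhds 0) → (∀ (L : ℕ) [NeZero L], L₀ ≤ L → Even L → let H : ℝ → Matrix (Finset (Literature.MathematicalPhysics.QuantumLattice
-- earlier StiffnessForcesCondensation (stmt-HubbardSuperconductivity-2100, replaced 2026-08-15T11:02:39Z -> stmt-HubbardSuperconductivity-2243): retired by None — ∀ (U δ ρ₀ η : ℝ) (w : ℕ → ℝ) (L₀ : ℕ), 0 < U → δ ∈ Set.Ioo (0 : ℝ) (1 / 2) → 0 < ρ₀ → 0 < η → Filter.Tendsto w Filter.atTop (nhds 0) → (∀ (L : ℕ) [NeZero L], L₀ ≤ L → Even L → let H : ℝ → Matrix (Finset (Literature.MathematicalPhysics.Quan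
/-- item stmt-HubbardSuperconductivity-2243 · crux · rank 4 · open · by planner
why it might fail: Converse Byers-Yang/Sewell (stiffness + hc/2e insensitivity => Yang ODLRO) is open even heuristically at T=0, d=2: LSY2005 Sec.5 'neither is necessary for the other' (1D hard-core bosons: rho_s>0, no BEC; 2D BKT at T>0); the every-GS quantifier lets growing degeneracy g_L fragment rho_2 (ev~cN/g_L).
sources: LiebSeiringerSolovejYngvason2005, Sewell1990, ByersYang1961, YangODLRO1962, Kohn1964, ScalapinoWhiteZhang1993
[crux, rank 4] THE BRIDGE — converse of 'ODLRO ⇒ flux quantisation' (Yang1962 §4, Sewell1990) at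
T=0, d=2, Literature-grade if true. ∀U>0, δ∈(0,1/2), ρ₀>0, w_L→0, L₀: IF the flux-threaded pure
torus satisfies (i) min(ρ₀θ², η)−w_L ≤ E_L(θ)−E_L(0) on |θ|≤π/2 (η>0) and (ii) |E_L(π)−E_L(0)| ≤
w_L, for all even L≥L₀ (same inline H, E_L as HiggsShadow), THEN every admissible sector
ground-state sequence (summit hypotheses) has, eventually along even sides 2k, a unit v and ev with
twoParticleRDM(ψ_{2k}) v = ev·v, ev ≥ c·N_{2k} (Yang ODLRO, channel-blind; a PDW passes by design).
Energies are sector minima, blind to WHICH ground state: finite symmetry degeneracy only rescales c.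
(i) excludes insulators (Kohn1964), (ii) metals, (i) at π/2 charge-4e; what is left is a charge-2e
superfluid, and at T=0, d=2 no stiff-but-uncondensed pair fluid is known — nor excluded (LSY2005
§5.2 p.40). Proof ideas: curvature in both directions ⇒ infrared bound for the pair phase (induced
2+1D XY model ordered; abelian duality), or contrapositive Koma–Tasaki-type 'no ODLRO ⇒ E_L flat or
hc/e-periodic'. Kill: a 2D lattice witness ⇒ restate ONCE adding a parity-gap hypothesis
chargeGap(N_L) ≥ 2Δ₀, then close. -/
@[route_item "route-HubbardSuperconductivity-EatTheGoldstone", crux]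
def StiffnessForcesCondensation : Prop :=
  ∀ (U δ ρ₀ η : ℝ) (w : ℕ → ℝ) (L₀ : ℕ), 0 < U → δ ∈ Set.Ioo (0 : ℝ) (1 / 2) → 0 < ρ₀ → 0 < η → Filter.Tendsto w Filter.atTop (nhds 0) → (∀ (L : ℕ) [NeZero L], L₀ ≤ L → Even L → let H : ℝ → Matrix (Finset (Literature.MathematicalPhysics.QuantumLattice.Orb (Literature.MathematicalPhysics.QuantumLattice.FermionTorus 2 L))) (Finset (Literature.MathematicalPhysics.QuantumLattice.Orb (Literature.MathematicalPhysics.QuantumLattice.FermionTorus 2 L))) ℂ := fun θ : ℝ => -(∑ x : Literature.MathematicalPhysics.QuantumLattice.FermionTorus 2 L, ∑ y : Literature.MathematicalPhysics.QuantumLattice.FermionTorus 2 L, ∑ σ : Fin 2, (if (Literature.MathematicalPhysics.QuantumLattice.fermionTorusGraph 2 L).Adj x y then Complex.exp (Complex.I * ((θ / L : ℝ) : ℂ) * (if Literature.MathematicalPhysics.QuantumLattice.FermionTorus.toTorusSite y = Literature.MathematicalPhysics.QuantumLattice.FermionTorus.toTorusSite x + Pi.single 0 1 ∧ Literature.MathematicalPhysics.QuantumLattice.FermionTorus.toTorusSite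 x ≠ Literature.MathematicalPhysics.QuantumLattice.FermionTorus.toTorusSite y + Pi.single 0 1 then (1 : ℂ) else if Literature.MathematicalPhysics.QuantumLattice.FermionTorus.toTorusSite x = Literature.MathematicalPhysics.QuantumLattice.FermionTorus.toTorusSite y + Pi.single 0 1 ∧ Literature.MathematicalPhysics.QuantumLattice.FermionTorus.toTorusSite y ≠ Literature.MathematicalPhysics.QuantumLattice.FermionTorus.toTorusSite x + Pi.single 0 1 then (-1 : ℂ) else 0)) • (Literature.MathematicalPhysics.QuantumLattice.creation (Literature.MathematicalPhysics.QuantumLattice.orb x σ) * Literature.MathematicalPhysics.QuantumLattice.annihilation (Literature.MathematicalPhysics.QuantumLattice.orb y σ)) else 0)) + (U : ℂ) • ∑ x : Literature.MathematicalPhysics.QuantumLattice.FermionTorus 2 L, Literature.MathematicalPhysics.QuantumLattice.numberOp x 0 * Literature.MathematicalPhysics.QuantumLattice.numberOp x 1; let E : ℝ → ℝ := fun θ => Matrix.minEnergyOn (H θ) (Literature.MathematicalPhysics.QuantumLattice.szSector (Λ := Literature.MathematicalPhysics.QuantumLattice.FermionTorus 2 L) (2 * ⌊(1 - δ) * (L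 : ℝ) ^ 2 / 2⌋₊) 0); (∀ θ : ℝ, |θ| ≤ Real.pi / 2 → min (ρ₀ * θ ^ 2) η - w L ≤ E θ - E 0) ∧ |E Real.pi - E 0| ≤ w L) → ∀ (N : ℕ → ℕ) (ψ : ∀ L, Literature.MathematicalPhysics.QuantumLattice.Fock (Literature.MathematicalPhysics.QuantumLattice.Orb (Literature.MathematicalPhysics.QuantumLattice.FermionTorus 2 L))), (∀ L, Even L → N L = 2 * ⌊(1 - δ) * (L : ℝ) ^ 2 / 2⌋₊ ∧ star (ψ L) ⬝ᵥ ψ L = 1 ∧ Literature.MathematicalPhysics.QuantumLattice.IsGroundStateInSector (Literature.MathematicalPhysics.QuantumLattice.hubbardTorus 2 L 1 U) (N L) 0 (ψ L)) → (∃ c : ℝ, 0 < c ∧ ∀ᶠ k : ℕ in Filter.atTop, ∃ v : Literature.MathematicalPhysics.QuantumLattice.Orb (Literature.MathematicalPhysics.QuantumLattice.FermionTorus 2 (2 * k)) × Literature.MathematicalPhysics.QuantumLattice.Orb (Literature.MathematicalPhysics.QuantumLattice.FermionTorus 2 (2 * k)) → ℂ, ∃ ev : ℝ, star v ⬝ᵥ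 v = 1 ∧ Matrix.mulVec (Literature.MathematicalPhysics.QuantumLattice.twoParticleRDM (ψ (2 * k))) v = (ev : ℂ) • v ∧ c * (N (2 * k) : ℝ) ≤ ev)

-- item stmt-HubbardSuperconductivity-13921 · support · rank 9 · open · by planner — informal only, no Lean statement yet:
--   [support, glue GaugedZ2TopologicalOrder (rev 6) ⇒ HiggsShadow clause (A)(ii) + LOCAL stiffness;
--   informal until cycle/Wilson-line operators of the gauged torus exist (definition want filed)] HIGGS
--   TRANSFER — the e → 0 return at FIXED L, matched to the repaired crux. Fix even L ≥ L₀ and (U,δ), ρ_L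
--   as in GaugedZ2TopologicalOrder. For e → 0 the physical gauged torus gaugedHubbardTorusPhys L U e M
--   ρ_L (M ≥ M₀(e,L)) is, up to errors O(e²·C(L)), the direct sum of: the two holonomy zero modes
--   (θ_x,θ_y) with kinetic term (e²/2)(p_x²+p_y²), p ∈ ℤ², in the Born–Oppenheimer potential
--   V_L(θ_x,θ_y) = E_L(θ_

-- item stmt-HubbardSuperconductivity-13922 · support · rank 9 · open · by planner — informal only, no Lean statement yet:
--   [support; informal — (1) is in tree in substance, (2)/(3) typable once cycle/Wilson-line operators
--   exist (definition want filed)] GAUGED DICTIONARY — three finite-L lemmas over gaugedHubbardTorus /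
--   gaugedHubbardTorusPhys (GaugedHubbardTorus.lean, electric-flux basis, e = Kogut–Susskind g). (1)
--   ELITZUR ON THE TORUS: every operator carrying nonzero charge under some Gauss generator G_y = (div
--   J)(y) − n_y + ρ_y has vanishing matrix elements between Gauss-law states; in particular ⟨Δ_d⟩,
--   ⟨c†c†⟩ and every charged local order parameter vanish identically in all cluster states — no
--   'obscured symmetry

-- item stmt-HubbardSuperconductivity-13923 · support · rank 9 · open · by planner — informal only, no Lean statement yet:
--   [support; informal until a local-indistinguishability notion for the Gauss-law-compressed
--   fermion⊗link torus lands (definition want GaugedHubbard.HasLTQO filed)] GAUGED LTQO — clause (b) of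
--   the rev-5 text of GaugedZ2TopologicalOrder, split off at rev 6 because it is neither typable today
--   nor consumed by the typed cone. With (U,δ,m,ρ,e₀,c,C,w) as in GaugedZ2TopologicalOrder and in the
--   Higgs regime w_L + C·e < c·e (so that (a1)∧(a2) pin an exact m-cluster below E₀ + c·e; let P be its
--   spectral projection): there is a decaying rate Δ : ℕ → ℝ such that for every ball B of radius r,
--   every ℓ with 2(r

/-- item stmt-HubbardSuperconductivity-1631 · support · rank 9 · closed · proved by Summit.HubbardSuperconductivity.HubbardSuperconductivity.Theorems.EatTheGoldstone.twistEnergyBounds_proof (prover) · by planner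
sources: Kohn1964, ByersYang1961, Tasaki2022, KomaTasakiPRL1992
[support, provable now; calibrates the inline flux-threaded torus of
HiggsShadow/StiffnessForcesCondensation] ∀U δ, L≥1, H(θ) = −Σ_{x∼y,σ} exp(iθs(x,y)/L) c†_{xσ}c_{yσ}
+ UΣn↑n↓ (s=+1 if y=x+e₁, −1 if x=y+e₁, else 0; s≡0 for L≤2), E(θ) = minEnergyOn (H θ) (szSector N_L
0): (a) H(0) = hubbardTorus 2 L 1 U (exp 0 = 1, one_smul; same sums as `hamiltonian`); (b)
E(−θ)=E(θ) (creation/annihilation/numberOp are real matrices: entrywise conjugation maps H(θ)↦H(−θ),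
preserves szSector and norms); (c) E(θ+2π)=E(θ) (large gauge transformation exp(2πiΣ_x x₁n_x/L):
single-valued, diagonal, sector-preserving; cf. HubbardGaugeBound.siteGauge); (d) L≥3: E(θ)−E(0) ≤
2θ² (ε-minimiser ψ of H(0); H(θ)−H(0) = (1−cos(θ/L))·(A+A†-part) + sin(θ/L)·current with A =
Σ_{x,σ}c†_x c_{x+e₁}, ‖A+A†‖ ≤ 4L²; (b) kills the odd current term: E(θ) = min(E(±θ)) ≤
E(0)+ε+4L²(1−cos(θ/L)) ≤ E(0)+ε+2θ²). Consequences: ρ₀ ≤ 2 in HiggsShadow; a-priori control of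
E_L(θ) for refuters' numerics. Sources: Kohn1964, ByersYang1961, Tasaki2022 §3.1, KomaTasakiPRL1992. -/
@[route_item "route-HubbardSuperconductivity-EatTheGoldstone"]
def TwistEnergyBounds : Prop :=
  ∀ (U δ : ℝ) (L : ℕ) [NeZero L], let H : ℝ → Matrix (Finset (Literature.MathematicalPhysics.QuantumLattice.Orb (Literature.MathematicalPhysics.QuantumLattice.FermionTorus 2 L))) (Finset (Literature.MathematicalPhysics.QuantumLattice.Orb (Literature.MathematicalPhysics.QuantumLattice.FermionTorus 2 L))) ℂ := fun θ : ℝ => -(∑ x : Literature.MathematicalPhysics.QuantumLattice.FermionTorus 2 L, ∑ y : Literature.MathematicalPhysics.QuantumLattice.FermionTorus 2 L, ∑ σ : Fin 2, (if (Literature.MathematicalPhysics.QuantumLattice.fermionTorusGraph 2 L).Adj x y then Complex.exp (Complex.I * ((θ / L : ℝ) : ℂ) * (if Literature.MathematicalPhysics.QuantumLattice.FermionTorus.toTorusSite y = Literature.MathematicalPhysics.QuantumLattice.FermionTorus.toTorusSite x + Pi.single 0 1 ∧ Literature.MathematicalPhysics.QuantumLattice.FermionTorus.toTorusSite x ≠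 Literature.MathematicalPhysics.QuantumLattice.FermionTorus.toTorusSite y + Pi.single 0 1 then (1 : ℂ) else if Literature.MathematicalPhysics.QuantumLattice.FermionTorus.toTorusSite x = Literature.MathematicalPhysics.QuantumLattice.FermionTorus.toTorusSite y + Pi.single 0 1 ∧ Literature.MathematicalPhysics.QuantumLattice.FermionTorus.toTorusSite y ≠ Literature.MathematicalPhysics.QuantumLattice.FermionTorus.toTorusSite x + Pi.single 0 1 then (-1 : ℂ) else 0)) • (Literature.MathematicalPhysics.QuantumLattice.creation (Literature.MathematicalPhysics.QuantumLattice.orb x σ) * Literature.MathematicalPhysics.QuantumLattice.annihilation (Literature.MathematicalPhysics.QuantumLattice.orb y σ)) else 0)) + (U : ℂ) • ∑ x : Literature.MathematicalPhysics.QuantumLattice.FermionTorus 2 L, Literature.MathematicalPhysics.QuantumLattice.numberOp x 0 * Literature.MathematicalPhysics.QuantumLattice.numberOp x 1; let E : ℝ → ℝ := fun θ => Matrix.minEnergyOn (H θ) (Literature.MathematicalPhysics.QuantumLattice.szSector (Λ := Literature.MathematicalPhysics.QuantumLattice.FermionTorus 2 L) (2 * ⌊(1 - δ) * (L : ℝ)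 ^ 2 / 2⌋₊) 0); (H 0 = Literature.MathematicalPhysics.QuantumLattice.hubbardTorus 2 L 1 U) ∧ (∀ θ : ℝ, E (-θ) = E θ) ∧ (∀ θ : ℝ, E (θ + 2 * Real.pi) = E θ) ∧ (3 ≤ L → δ ∈ Set.Ioo (0 : ℝ) (1 / 2) → ∀ θ : ℝ, E θ - E 0 ≤ 2 * θ ^ 2)

-- item stmt-HubbardSuperconductivity-2339 · support · rank 9 · open · by planner — informal only, no Lean statement yet:
--   [support; informal until gaugedHubbardTorus lands] LATTICE WARD IDENTITY / PHOTON MASS at finite L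
--   ('m_γ² = e²ρ_s' on the torus). For the minimally coupled torus at fixed even L: (a) gauge invariance
--   — H_e commutes with every Gauss-law generator G_x = (div E)(x) − e(n_x − ν) and with the large gauge
--   transformations; matter energies depend on a STATIC background vector potential only through its
--   holonomy class (cf. the siteGauge algebra of Literature HubbardGaugeBound, reusable verbatim); (b)
--   Kohn/SWZ identity — the second derivative of the matter sector ground energy under a uniform static
--   x-p

-- item stmt-HubbardSuperconductivity-2362 · support · rank 9 · open · by planner — informal only, no Lean statement yet:
--   [support; informal until the anchor Hamiltonian is a Lean object (the κ → ∞ limit of definition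
--   request gaugedHubbardTorus, or a stand-alone Z₂ gauge–Higgs torus as an `Interaction`)] TORIC-CODE
--   ANCHOR. In the gauged PAIR-BOSON family (charge-2 hard-core bosons b_R — the plaquette/BEC-side
--   d-wave pairs of routes PairBosonDome / PlaquetteBoson and card plaquette-boson-kls-anchor — hopping
--   through U_{RR'}², links U = exp(i a)), sending the boson hopping κ → ∞ freezes U² = 1 in unitary
--   gauge, U = ±1 =: σᶻ, and leaves the 2+1D Z₂ lattice gauge theory H_anchor(K,Γ) = −K Σ_p Π_{b∈p} σᶻ_b
--   − Γ Σ_b σˣ_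

/-- item stmt-HubbardSuperconductivity-1632 · assembly · rank 1 · closed · proved by Summit.HubbardSuperconductivity.HubbardSuperconductivity.Theorems.eatTheGoldstone_assembly_proof @ acc811950f99 (prover) · by planner
sources: HanssonOganesyanSondhi2004
[assembly] HiggsShadow → StiffnessForcesCondensation → HubbardSuperconductivity. Pure logic (checked
by `example` in the planner's Sketch.lean, lean check rc 0): unfold HubbardSuperconductivity to
Literature.Hubbard.DWaveSuperconductivityHubbard; take (U,δ) and the shadow data (ρ₀,w,L₀) from
HiggsShadow; for an admissible (N,ψ) the Bridge yields the macroscopic ρ₂-eigenpair clause, and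
HiggsShadow's selection clause maps it to HasLongRangeOrder (fun k => halfOpenBox 2 (2k)) (fun k =>
torusPullback (pairFieldCorr dWaveFormFactor ψ) (2k)). The hypotheses/eigenpair sub-terms are
byte-identical across the three decls by construction. -/
@[route_item "route-HubbardSuperconductivity-EatTheGoldstone"]
def Assembly : Prop :=
  HiggsShadow → StiffnessForcesCondensation → HubbardSuperconductivity

/-! D-0027 §2.1 — DECIDING THEOREM (planner-authored via `route open/edit --closes-file`; by planner-rbadge-HubbardSuperconductivity-EatThe-c4e7317e-g2-0 2026-08-15T16:11:16Z):
its hypotheses are this route's items and its conclusion the sub-problem Statement (glue_lint), and it elaborates with this file. -/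

@[closes "route-HubbardSuperconductivity-EatTheGoldstone"] theorem closes (hShadow : HiggsShadow) (hBridge : StiffnessForcesCondensation) :
    _root_.HubbardSuperconductivity := by
  obtain ⟨U, hU, δ, hδ, ⟨ρ₀, hρ₀, η, hη, w, hw, L₀, hflux⟩, hsel⟩ := hShadow
  unfold _root_.HubbardSuperconductivity Literature.Hubbard.DWaveSuperconductivityHubbard
  refine ⟨U, hU, δ, hδ, fun N ψ hadm => ?_⟩
  exact hsel N ψ hadm (hBridge U δ ρ₀ η w L₀ hU hδ hρ₀ hη hw hflux N ψ hadm)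

end Summit.HubbardSuperconductivity.HubbardSuperconductivity.Theses.EatTheGoldstone
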